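import Mathlib
import HarnessLib
import Summits.AtomisticToContinuum.FouriersLaw.Theses.StaticAbelianSqueeze
import Summits.AtomisticToContinuum.FouriersLaw.Theses.EmbeddedDrudeMourre
import Summits.AtomisticToContinuum.FouriersLaw.Theorems.LatticeLandauDampingAbelThermodynamicLimitAutocorrIntegrableOn
import Summits.AtomisticToContinuum.FouriersLaw.Theorems.StaticAbelianSqueezeUniformAbelianRegularityMonotoneWindow
import Summits.AtomisticToContinuum.FouriersLaw.Theorems.StaticAbelianSqueezeUniformAbelianRegularityWindowTransform
import Summits.AtomisticToContinuum.FouriersLaw.Theorems.StaticAbelianSqueezeUniformAbelianRegularityZeroMeanWindow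

/-!
# Certificate of line `Sketch` (zero-mean-dyadic-splice) for the crux `UniformAbelianRegularity` = (R)
(item stmt-AtomisticToContinuum-13416; lead prover-line-stmt-AtomisticToContinuum-13416-0, 2026-08-17; `--supports` file proving the
registered glue stub `stub_regularityOfSpliceAndTails`; closes nothing)

For the OPEN pinned anharmonic chain `pinnedChain ω₂ lam β γ` (all `> 0`) with both baths at `T > 0`, write
`c_N(t) = ∫ J·(P_t J) dμ_{N,T}` (`J = Σ_i j_i`, `μ_{N,T} = gibbsMeasure N T`, `P_t = transitionKernel N T T t`) and
`S_N(ν) = ∫₀^∞ (1 − e^{−νt}) c_N(t) dt`.  (R) says: `∀ ε ∃ ν₀ ∀ ν ∈ (0,ν₀)`, eventually in `N`, `|S_N(ν)| ≤ εN`.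

**Theorem (`stub_regularityOfSpliceAndTails`).** (R) follows from two statements about the open chain:
* (K3 ∧ K2 ∧ K4, "bulk–contact splice") a bulk function `C(t) = ∫ cos(ωt) dσ(ω)` (finite `σ`, with a density `g ≥ 0` on a
  window `(−δ₀,δ₀)` that is CONTINUOUS AT `0`), an `N`-free locally integrable end correction `E` with Cesàro-small mass
  `∫₀^τ|E| = o(τ)`, and the integrated light-cone splice `∫₀^{c₀N} |c_N − (N−1)C − E| ≤ K` (`N ≥ N₁`);
* (K1, "post-crossing signed tails") `∀ c₀ > 0 ∀ ε > 0`, eventually in `N`, `sup_{ξ ≥ c₀N} |∫_ξ^∞ c_N| ≤ εN`.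

Proof (the zero-mean Abel window): cut `1 − e^{−νt} = W + L` with the smooth window `W(t) = χ(t/c₀N)(1 − e^{−νt})` (cubic
`C¹` smooth-step `χ`).  LATE: `L` is continuous, monotone, `0` on `[0, c₀N/2]`, `≤ 1`, so Bonnet's bound (`stub_monotoneWindow`,
LANDED) and K1 give `|∫ L c_N| ≤ εN/8`.  EARLY: the splice turns `∫ W c_N` into `(N−1)∫ W C + ∫ W E + ∫ W R` with
`|∫ W E| ≤ ∫₀^{c₀N}|E| ≤ εN/8`, `|∫ W R| ≤ K ≤ εN/8`, and `|∫ W C| ≤ ε/8` by the ZERO-MEAN WINDOW LEMMA (`stub_zeroMeanWindow`, LANDED)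
fed with the transform bounds of the explicit window (`stub_windowTransform`, LANDED): because `W(0) = 0`, the bulk enters only
through the continuity of `g` at `0`.  Fixed-`N` integrability of `c_N` is the LANDED `stub_autocorrIntegrableOn` (p144688).

The two hypotheses are the registered open stubs `stub_bulkContactSplice`, `stub_postCrossingTails` of the skeleton
`Cruxes/UniformAbelianRegularity/Lines/Sketch.lean`; both are physical, open-problem-class statements (the second is where
`lam, β > 0` must act: it fails at the harmonic corner).  References: Bonetto–Lebowitz–Rey-Bellet 2000 §7; Kundu–Dhar–Narayan 2009.
No named fact is used; nothing here closes the item.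
-/

noncomputable section

namespace Summit.AtomisticToContinuum.FouriersLaw.Theorems.UniformAbelianRegularity.ZeroMeanDyadicSplice

open MeasureTheory Set Filter Topology

/-! ## The explicit smooth-step -/

/-- The cubic smooth-step takes values in `[0, 1]`. -/
theorem smoothstep_mem_Icc (s : ℝ) :
    (if s ≤ 1 / 2 then (1:ℝ) else if 1 ≤ s then 0 else 1 - 3 * (2 * s - 1) ^ 2 + 2 * (2 * s - 1) ^ 3) ∈ Set.Icc (0:ℝ) 1 := by
  split_ifs with h1 h2
  · exact ⟨zero_le_one, le_rfl⟩
  · exact ⟨le_rfl, zero_le_one⟩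
  · push Not at h1 h2
    have hu0 : 0 ≤ 2 * s - 1 := by linarith
    have hu1 : 2 * s - 1 ≤ 1 := by linarith
    constructor <;> nlinarith [mul_nonneg hu0 hu0, mul_nonneg (mul_nonneg hu0 hu0) hu0,
      mul_nonneg (sub_nonneg.2 hu1) hu0, mul_nonneg (mul_nonneg (sub_nonneg.2 hu1) hu0) hu0,
      mul_nonneg (mul_nonneg (sub_nonneg.2 hu1) (sub_nonneg.2 hu1)) hu0]

/-- The cubic smooth-step is antitone. -/
theorem smoothstep_antitone :
    Antitone (fun s : ℝ => if s ≤ 1 / 2 then (1:ℝ) else if 1 ≤ s then 0 else 1 - 3 * (2 * s - 1) ^ 2 + 2 * (2 * s - 1) ^ 3) := by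
  -- the middle polynomial `p(u) = 1 - 3u² + 2u³` is antitone on `[0,1]`: `p(u) - p(v) = (v-u)(3(u+v) - 2(u²+uv+v²)) ≥ 0` for `u ≤ v`
  have hp : ∀ u v : ℝ, 0 ≤ u → u ≤ v → v ≤ 1 →
      1 - 3 * v ^ 2 + 2 * v ^ 3 ≤ 1 - 3 * u ^ 2 + 2 * u ^ 3 := by
    intro u v hu huv hv
    have hvu : 0 ≤ v - u := sub_nonneg.2 huv
    nlinarith [mul_nonneg hvu hu, mul_nonneg hvu (sub_nonneg.2 hv), mul_nonneg (mul_nonneg hvu hu) (sub_nonneg.2 hv),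
      mul_nonneg (mul_nonneg hvu hu) hu, mul_nonneg (mul_nonneg hvu (sub_nonneg.2 hv)) (sub_nonneg.2 hv),
      mul_nonneg (mul_nonneg hvu hvu) hu, mul_nonneg (mul_nonneg hvu hvu) (sub_nonneg.2 hv)]
  intro s s' hss'
  have hmem := smoothstep_mem_Icc s
  have hmem' := smoothstep_mem_Icc s'
  simp only at hmem hmem' ⊢
  by_cases h1 : s ≤ 1 / 2
  · rw [if_pos h1]; exact hmem'.2
  · rw [if_neg h1]
    have h1' : ¬ s' ≤ 1 / 2 := fun h => h1 (hss'.trans h)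
    rw [if_neg h1'] at hmem' ⊢
    by_cases h2 : 1 ≤ s
    · rw [if_pos h2, if_pos (h2.trans hss')]
    · rw [if_neg h2]
      rw [if_neg h2] at hmem
      by_cases h2' : 1 ≤ s'
      · rw [if_pos h2']; rw [if_neg h1] at hmem; exact hmem.1
      · rw [if_neg h2']
        push Not at h1 h2 h2'
        have := hp (2 * s - 1) (2 * s' - 1) (by linarith) (by linarith) (by linarith)
        exact this

/-- The cubic smooth-step is continuous. -/
theorem smoothstep_continuous :
    Continuous (fun s : ℝ => if s ≤ 1 / 2 then (1:ℝ) else if 1 ≤ s then 0 else 1 - 3 * (2 * s - 1) ^ 2 + 2 * (2 * s - 1) ^ 3) := by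
  have h_inner : Continuous (fun s : ℝ => if 1 ≤ s then (0:ℝ) else 1 - 3 * (2 * s - 1) ^ 2 + 2 * (2 * s - 1) ^ 3) := by
    refine Continuous.if_le continuous_const (by fun_prop) continuous_const continuous_id ?_
    intro x hx
    rw [← hx]; norm_num
  refine Continuous.if_le continuous_const h_inner continuous_id continuous_const ?_
  intro x hx
  rw [hx]; norm_num

/-! ## The certificate -/

/-- **(R) ⇐ bulk–contact splice ∧ post-crossing signed tails** (registered glue stub `stub_regularityOfSpliceAndTails` of line
`Sketch`, crux stmt-AtomisticToContinuum-13416): the two physical statements imply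
`EmbeddedDrudeMourre.UniformAbelianRegularity` BY NAME (the `StaticAbelianSqueeze` / `HoelderEscapeProfile` / `CoercivePulse` /
`CageBudgetFekete` copies are the same term, `uniformAbelianRegularity_edm_eq_sas`).  Zero-mean Abel window at the linear horizon
`c₀N`; see the module docstring. [folklore] -/
theorem stub_regularityOfSpliceAndTails :
    (∀ ω₂ lam β γ : ℝ, 0 < ω₂ → 0 < lam → 0 < β → 0 < γ → ∀ T : ℝ, 0 < T →
      ∃ (C E g : ℝ → ℝ) (σ : MeasureTheory.Measure ℝ) (c₀ δ₀ K : ℝ) (N₁ : ℕ),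
        0 < c₀ ∧ 0 < δ₀ ∧ 0 ≤ K ∧ MeasureTheory.IsFiniteMeasure σ ∧ Measurable g ∧ Measurable E ∧
        (∀ t : ℝ, 0 < t → C t = ∫ ω, Real.cos (ω * t) ∂σ) ∧
        σ.restrict (Set.Ioo (-δ₀) δ₀) =
          (MeasureTheory.volume.restrict (Set.Ioo (-δ₀) δ₀)).withDensity (fun ω => ENNReal.ofReal (g ω)) ∧
        (∀ ω ∈ Set.Ioo (-δ₀) δ₀, 0 ≤ g ω) ∧ ContinuousAt g 0 ∧
        (∀ τ : ℝ, 0 < τ → MeasureTheory.IntegrableOn E (Set.Ioc 0 τ)) ∧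
        (∀ ε : ℝ, 0 < ε → ∃ τ₀ : ℝ, 0 < τ₀ ∧ ∀ τ : ℝ, τ₀ ≤ τ → ∫ t in Set.Ioc 0 τ, |E t| ≤ ε * τ) ∧
        (∀ N : ℕ, N₁ ≤ N → let J : Literature.MathematicalPhysics.KineticTheory.HeatConduction.PhaseSpace N → ℝ := fun z => ∑ i : Fin N, (Literature.MathematicalPhysics.KineticTheory.HeatConduction.pinnedChain ω₂ lam β γ).bondCurrent N i z; ∫ t in Set.Ioc 0 (c₀ * N), |(∫ z, J z * (∫ y, J y ∂((Literature.MathematicalPhysics.KineticTheory.HeatConduction.pinnedChain ω₂ lam β γ).transitionKernel N T T t.toNNReal z)) ∂((Literature.MathematicalPhysics.KineticTheory.HeatConduction.pinnedChain ω₂ lam β γ).gibbsMeasure N T)) - ((N:ℝ) - 1) * C t - E t| ≤ K)) →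
    (∀ ω₂ lam β γ : ℝ, 0 < ω₂ → 0 < lam → 0 < β → 0 < γ → ∀ T : ℝ, 0 < T → ∀ c₀ : ℝ, 0 < c₀ → ∀ ε : ℝ, 0 < ε →
      ∃ N₀ : ℕ, ∀ N : ℕ, N₀ ≤ N → ∀ ξ : ℝ, c₀ * N ≤ ξ → let J : Literature.MathematicalPhysics.KineticTheory.HeatConduction.PhaseSpace N → ℝ := fun z => ∑ i : Fin N, (Literature.MathematicalPhysics.KineticTheory.HeatConduction.pinnedChain ω₂ lam β γ).bondCurrent N i z; |∫ s in Set.Ioi ξ, ∫ z, J z * (∫ y, J y ∂((Literature.MathematicalPhysics.KineticTheory.HeatConduction.pinnedChain ω₂ lam β γ).transitionKernel N T T s.toNNReal z)) ∂((Literature.MathematicalPhysics.KineticTheory.HeatConduction.pinnedChain ω₂ lam β γ).gibbsMeasure N T)| ≤ ε * N) →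
    _root_.Summit.AtomisticToContinuum.FouriersLaw.Theses.EmbeddedDrudeMourre.UniformAbelianRegularity := by
  intro h1 h3 ω₂ lam β γ hω hl hβ hγ T hT ε hε
  obtain ⟨C, E, g, σ, c₀, δ₀, K, N₁, hc₀, hδ₀, hK, hσfin, hgm, hEm, hCσ, hσg, hg0, hgc, hEint, hCes, hmatch⟩ :=
    h1 ω₂ lam β γ hω hl hβ hγ T hT
  have hε8 : 0 < ε / 8 := by positivity
  obtain ⟨ν₁, hν₁, τ₁, hτ₁, h6'⟩ := stub_zeroMeanWindow σ g δ₀ 12 hσfin hδ₀ (by norm_num) hgm hg0 hgc hσg (ε / 8) hε8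
  obtain ⟨τ₀, hτ₀, hCes'⟩ := hCes (ε / (8 * c₀)) (by positivity)
  refine ⟨min ν₁ 1, lt_min hν₁ one_pos, fun ν hν hνlt => ?_⟩
  have hνν₁ : ν ≤ ν₁ := (hνlt.trans_le (min_le_left _ _)).le
  obtain ⟨N₃, hN₃⟩ := h3 ω₂ lam β γ hω hl hβ hγ T hT (c₀ / 2) (by positivity) (ε / 8) hε8
  refine ⟨max (max N₁ N₃) (⌈max τ₀ τ₁ / c₀⌉₊ + ⌈8 * K / ε⌉₊ + 1), fun N hN => ?_⟩
  have hN₁N : N₁ ≤ N := le_trans (le_trans (le_max_left _ _) (le_max_left _ _)) hN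
  have hN₃N : N₃ ≤ N := le_trans (le_trans (le_max_right _ _) (le_max_left _ _)) hN
  have hbig : ⌈max τ₀ τ₁ / c₀⌉₊ + ⌈8 * K / ε⌉₊ + 1 ≤ N := le_trans (le_max_right _ _) hN
  have hN1 : 1 ≤ N := by omega
  have hNr1 : (1:ℝ) ≤ N := by exact_mod_cast hN1
  have hNr0 : (0:ℝ) ≤ N := Nat.cast_nonneg N
  have hτN : max τ₀ τ₁ ≤ c₀ * N := by
    have h1' : max τ₀ τ₁ / c₀ ≤ ⌈max τ₀ τ₁ / c₀⌉₊ := Nat.le_ceil _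
    have h2' : (⌈max τ₀ τ₁ / c₀⌉₊ : ℝ) ≤ N := by exact_mod_cast (by omega : ⌈max τ₀ τ₁ / c₀⌉₊ ≤ N)
    have h3' := (div_le_iff₀ hc₀).1 (h1'.trans h2')
    linarith [mul_comm (N:ℝ) c₀]
  have hKN : K ≤ ε / 8 * N := by
    have h1' : 8 * K / ε ≤ ⌈8 * K / ε⌉₊ := Nat.le_ceil _
    have h2' : (⌈8 * K / ε⌉₊ : ℝ) ≤ N := by exact_mod_cast (by omega : ⌈8 * K / ε⌉₊ ≤ N)
    have h3' := (div_le_iff₀ hε).1 (h1'.trans h2')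
    nlinarith
  intro J
  set P := Literature.MathematicalPhysics.KineticTheory.HeatConduction.pinnedChain ω₂ lam β γ with hP_def
  -- the autocorrelation `c_N`
  set cN : ℝ → ℝ := fun t => ∫ z, J z * (∫ y, J y ∂(P.transitionKernel N T T t.toNNReal z)) ∂(P.gibbsMeasure N T)
    with hcN_def
  show |∫ t in Set.Ioi (0:ℝ), (1 - Real.exp (-(ν * t))) * cN t| ≤ ε * N
  -- fixed-`N` integrability (LANDED, p144688)
  have hint : IntegrableOn cN (Ioi 0) :=
    Summit.AtomisticToContinuum.FouriersLaw.Theorems.AbelThermodynamicLimit.SeriesLawAtEveryLaplaceFrequency.stub_autocorrIntegrableOn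
      ω₂ lam β γ hω hl hβ hγ T hT N
  -- the horizon
  set τ : ℝ := c₀ * N with hτ_def
  have hτ0 : 0 < τ := by positivity
  have hττ₀ : τ₀ ≤ τ := le_trans (le_max_left _ _) hτN
  have hττ₁ : τ₁ ≤ τ := le_trans (le_max_right _ _) hτN
  -- the windows
  set χ : ℝ → ℝ := fun s => if s ≤ 1 / 2 then (1:ℝ) else if 1 ≤ s then 0 else 1 - 3 * (2 * s - 1) ^ 2 + 2 * (2 * s - 1) ^ 3
    with hχ_def
  have hχI : ∀ s, χ s ∈ Icc (0:ℝ) 1 := fun s => smoothstep_mem_Icc s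
  have hχanti : Antitone χ := smoothstep_antitone
  have hχcont : Continuous χ := smoothstep_continuous
  have hχ_one : ∀ s : ℝ, s ≤ 1 / 2 → χ s = 1 := fun s hs => by
    simp only [hχ_def, if_pos hs]
  have hχ_zero : ∀ s : ℝ, 1 ≤ s → χ s = 0 := fun s hs => by
    have h' : ¬ s ≤ 1 / 2 := not_le.2 (by linarith)
    simp only [hχ_def, if_neg h', if_pos hs]
  set W : ℝ → ℝ := fun t => χ (t / τ) * (1 - Real.exp (-(ν * t))) with hW_def
  set L : ℝ → ℝ := fun t => (1 - χ (t / τ)) * (1 - Real.exp (-(ν * t))) with hL_def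
  have hw0 : ∀ t : ℝ, 0 < t → 0 ≤ 1 - Real.exp (-(ν * t)) := fun t ht => by
    have h : Real.exp (-(ν * t)) ≤ 1 := Real.exp_le_one_iff.2 (by nlinarith [mul_pos hν ht])
    linarith
  have hw1 : ∀ t : ℝ, 1 - Real.exp (-(ν * t)) ≤ 1 := fun t => by linarith [Real.exp_pos (-(ν * t))]
  have hWcont : Continuous W := (hχcont.comp (continuous_id.div_const τ)).mul (by fun_prop)
  have hLcont : Continuous L := (continuous_const.sub (hχcont.comp (continuous_id.div_const τ))).mul (by fun_prop)
  have hWbd : ∀ t : ℝ, 0 < t → |W t| ≤ 1 := fun t ht => by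
    simp only [hW_def]
    rw [abs_mul, abs_of_nonneg (hχI _).1, abs_of_nonneg (hw0 t ht)]
    exact mul_le_one₀ (hχI _).2 (hw0 t ht) (hw1 t)
  have hWzero : ∀ t : ℝ, τ ≤ t → W t = 0 := fun t ht => by
    have h' : 1 ≤ t / τ := by rwa [le_div_iff₀ hτ0, one_mul]
    simp only [hW_def, hχ_zero _ h', zero_mul]
  have hLzero : ∀ t : ℝ, t ≤ τ / 2 → L t = 0 := fun t ht => by
    have h' : t / τ ≤ 1 / 2 := by rw [div_le_iff₀ hτ0]; linarith
    simp only [hL_def, hχ_one _ h', sub_self, zero_mul]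
  have hLa : L (τ / 2) = 0 := hLzero _ le_rfl
  have hLnn : ∀ t : ℝ, 0 ≤ L t := fun t => by
    by_cases ht : t ≤ τ / 2
    · rw [hLzero t ht]
    · push Not at ht
      have ht0 : 0 < t := by linarith
      exact mul_nonneg (by linarith [(hχI (t / τ)).2]) (hw0 t ht0)
  have hLle : ∀ t : ℝ, L t ≤ 1 := fun t => by
    by_cases ht : t ≤ τ / 2
    · rw [hLzero t ht]; exact zero_le_one
    · push Not at ht
      have ht0 : 0 < t := by linarith
      exact mul_le_one₀ (by linarith [(hχI (t / τ)).1]) (hw0 t ht0) (hw1 t)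
  have hLmono : Monotone L := by
    intro t t' htt'
    by_cases ht : t ≤ τ / 2
    · rw [hLzero t ht]; exact hLnn t'
    · push Not at ht
      have ht0 : 0 < t := by linarith
      have ht'0 : 0 < t' := by linarith
      apply mul_le_mul
      · have : χ (t' / τ) ≤ χ (t / τ) := hχanti (div_le_div_of_nonneg_right htt' hτ0.le)
        linarith
      · have : Real.exp (-(ν * t')) ≤ Real.exp (-(ν * t)) := Real.exp_le_exp.2 (by nlinarith)
        linarith
      · exact hw0 t ht0
      · linarith [(hχI (t' / τ)).2]
  have hWL : ∀ t : ℝ, (1 - Real.exp (-(ν * t))) = W t + L t := fun t => by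
    simp only [hW_def, hL_def]; ring
  -- integrability of the weighted autocorrelation and the split `S_N = ∫ W c_N + ∫ L c_N`
  have hWint : IntegrableOn (fun t => W t * cN t) (Ioi 0) := by
    refine Integrable.bdd_mul hint hWcont.aestronglyMeasurable (c := 1) ?_
    exact (ae_restrict_iff' measurableSet_Ioi).2 (Eventually.of_forall fun t ht => by
      rw [Real.norm_eq_abs]; exact hWbd t ht)
  have hLint : IntegrableOn (fun t => L t * cN t) (Ioi 0) := by
    refine Integrable.bdd_mul hint hLcont.aestronglyMeasurable (c := 1) ?_
    exact Eventually.of_forall fun t => by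
      rw [Real.norm_eq_abs, abs_of_nonneg (hLnn t)]; exact hLle t
  have hsplit : ∫ t in Ioi (0:ℝ), (1 - Real.exp (-(ν * t))) * cN t =
      (∫ t in Ioi (0:ℝ), W t * cN t) + ∫ t in Ioi (0:ℝ), L t * cN t := by
    have hpt : ∀ t, (1 - Real.exp (-(ν * t))) * cN t = W t * cN t + L t * cN t := fun t => by
      rw [hWL t]; ring
    simp_rw [hpt]
    exact integral_add hWint hLint
  -- LATE WINDOW: Bonnet (stub P2) + post-crossing tails (stub K1)
  have hlate : |∫ t in Ioi (0:ℝ), L t * cN t| ≤ ε / 8 * N := by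
    have hτ2 : (0:ℝ) ≤ τ / 2 := by positivity
    have heq : ∫ t in Ioi (0:ℝ), L t * cN t = ∫ t in Ioi (τ / 2), L t * cN t := by
      rw [← Ioc_union_Ioi_eq_Ioi hτ2, setIntegral_union (Ioc_disjoint_Ioi le_rfl) measurableSet_Ioi
        (hLint.mono_set Ioc_subset_Ioi_self) (hLint.mono_set (Ioi_subset_Ioi hτ2))]
      rw [setIntegral_eq_zero_of_forall_eq_zero (fun t ht => by rw [hLzero t ht.2, zero_mul]), zero_add]
    rw [heq]
    refine stub_monotoneWindow cN L (τ / 2) (ε / 8 * N) (hint.mono_set (Ioi_subset_Ioi hτ2)) hLmono hLcont hLa hLle ?_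
    intro ξ hξ
    have hξ' : c₀ / 2 * N ≤ ξ := by
      have : c₀ / 2 * N = τ / 2 := by simp only [hτ_def]; ring
      linarith
    exact hN₃ N hN₃N ξ hξ'
  -- EARLY WINDOW: splice (stub K3/K2/K4) + zero-mean window lemma (stubs P3a/P3b)
  haveI := hσfin
  set Cσ : ℝ → ℝ := fun t => ∫ ω, Real.cos (ω * t) ∂σ with hCσ_def
  have hCσcont : Continuous Cσ := by
    refine continuous_of_dominated (bound := fun _ => (1:ℝ)) ?_ ?_ (integrable_const _) ?_
    · intro t; exact Continuous.aestronglyMeasurable (by fun_prop)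
    · intro t; exact Eventually.of_forall fun ω => by rw [Real.norm_eq_abs]; exact Real.abs_cos_le_one _
    · exact Eventually.of_forall fun ω => by fun_prop
  have hCeq : ∀ t ∈ Ioc (0:ℝ) τ, C t = Cσ t := fun t ht => hCσ t ht.1
  have hCσint : IntegrableOn Cσ (Ioc 0 τ) := (hCσcont.integrableOn_Icc).mono_set Ioc_subset_Icc_self
  have hCint : IntegrableOn C (Ioc 0 τ) := hCσint.congr_fun (fun t ht => (hCeq t ht).symm) measurableSet_Ioc
  have hEint' : IntegrableOn E (Ioc 0 τ) := hEint τ hτ0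
  have hcNint' : IntegrableOn cN (Ioc 0 τ) := hint.mono_set Ioc_subset_Ioi_self
  set R : ℝ → ℝ := fun t => cN t - ((N:ℝ) - 1) * C t - E t with hR_def
  have hRint : IntegrableOn R (Ioc 0 τ) := (hcNint'.sub (hCint.const_mul _)).sub hEint'
  have hmatch' : ∫ t in Ioc (0:ℝ) τ, |R t| ≤ K := hmatch N hN₁N
  have hWbd' : ∀ᵐ t ∂(volume.restrict (Ioc (0:ℝ) τ)), ‖W t‖ ≤ 1 :=
    (ae_restrict_iff' measurableSet_Ioc).2 (Eventually.of_forall fun t ht => by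
      rw [Real.norm_eq_abs]; exact hWbd t ht.1)
  have hWC : IntegrableOn (fun t => W t * C t) (Ioc 0 τ) := Integrable.bdd_mul hCint hWcont.aestronglyMeasurable hWbd'
  have hWE : IntegrableOn (fun t => W t * E t) (Ioc 0 τ) := Integrable.bdd_mul hEint' hWcont.aestronglyMeasurable hWbd'
  have hWR : IntegrableOn (fun t => W t * R t) (Ioc 0 τ) := Integrable.bdd_mul hRint hWcont.aestronglyMeasurable hWbd'
  have hearly_eq : ∫ t in Ioi (0:ℝ), W t * cN t = ∫ t in Ioc (0:ℝ) τ, W t * cN t := by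
    rw [← Ioc_union_Ioi_eq_Ioi hτ0.le, setIntegral_union (Ioc_disjoint_Ioi le_rfl) measurableSet_Ioi
      (hWint.mono_set Ioc_subset_Ioi_self) (hWint.mono_set (Ioi_subset_Ioi hτ0.le))]
    rw [setIntegral_eq_zero_of_forall_eq_zero (t := Ioi τ)
      (fun t ht => by rw [hWzero t (le_of_lt ht), zero_mul]), add_zero]
  have hdecomp : ∫ t in Ioc (0:ℝ) τ, W t * cN t =
      ((N:ℝ) - 1) * (∫ t in Ioc (0:ℝ) τ, W t * C t) + (∫ t in Ioc (0:ℝ) τ, W t * E t) +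
        ∫ t in Ioc (0:ℝ) τ, W t * R t := by
    have hpt : ∀ t, W t * cN t = ((N:ℝ) - 1) * (W t * C t) + W t * E t + W t * R t := fun t => by
      simp only [hR_def]; ring
    have i1 : Integrable (fun t => ((N:ℝ) - 1) * (W t * C t)) (volume.restrict (Ioc (0:ℝ) τ)) := hWC.const_mul _
    have i12 : Integrable (fun t => ((N:ℝ) - 1) * (W t * C t) + W t * E t) (volume.restrict (Ioc (0:ℝ) τ)) :=
      i1.add hWE
    simp_rw [hpt]
    rw [integral_add i12 hWR, integral_add i1 hWE, integral_const_mul]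
  have hE_bd : |∫ t in Ioc (0:ℝ) τ, W t * E t| ≤ ε / 8 * N := by
    calc |∫ t in Ioc (0:ℝ) τ, W t * E t| ≤ ∫ t in Ioc (0:ℝ) τ, |W t * E t| := abs_integral_le_integral_abs
      _ ≤ ∫ t in Ioc (0:ℝ) τ, |E t| :=
          setIntegral_mono_on hWE.abs hEint'.abs measurableSet_Ioc (fun t ht => by
            rw [abs_mul]; exact mul_le_of_le_one_left (abs_nonneg _) (hWbd t ht.1))
      _ ≤ ε / (8 * c₀) * τ := hCes' τ hττ₀
      _ = ε / 8 * N := by simp only [hτ_def]; field_simp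
  have hR_bd : |∫ t in Ioc (0:ℝ) τ, W t * R t| ≤ ε / 8 * N := by
    calc |∫ t in Ioc (0:ℝ) τ, W t * R t| ≤ ∫ t in Ioc (0:ℝ) τ, |W t * R t| := abs_integral_le_integral_abs
      _ ≤ ∫ t in Ioc (0:ℝ) τ, |R t| :=
          setIntegral_mono_on hWR.abs hRint.abs measurableSet_Ioc (fun t ht => by
            rw [abs_mul]; exact mul_le_of_le_one_left (abs_nonneg _) (hWbd t ht.1))
      _ ≤ K := hmatch'
      _ ≤ ε / 8 * N := hKN
  have hC_bd : |∫ t in Ioc (0:ℝ) τ, W t * C t| ≤ ε / 8 := by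
    have heq1 : ∫ t in Ioc (0:ℝ) τ, W t * C t = ∫ t in Ioc (0:ℝ) τ, W t * Cσ t :=
      setIntegral_congr_fun measurableSet_Ioc (fun t ht => by simp only [hCeq t ht])
    have hWCσ : IntegrableOn (fun t => W t * Cσ t) (Ioi 0) := by
      rw [← Ioc_union_Ioi_eq_Ioi hτ0.le]
      refine IntegrableOn.union (Integrable.bdd_mul hCσint hWcont.aestronglyMeasurable hWbd') ?_
      refine integrableOn_zero.congr_fun ?_ measurableSet_Ioi
      intro t ht
      simp only [hWzero t (le_of_lt ht), zero_mul]
    have heq2 : ∫ t in Ioi (0:ℝ), W t * Cσ t = ∫ t in Ioc (0:ℝ) τ, W t * Cσ t := by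
      rw [← Ioc_union_Ioi_eq_Ioi hτ0.le, setIntegral_union (Ioc_disjoint_Ioi le_rfl) measurableSet_Ioi
        (hWCσ.mono_set Ioc_subset_Ioi_self) (hWCσ.mono_set (Ioi_subset_Ioi hτ0.le))]
      rw [setIntegral_eq_zero_of_forall_eq_zero (t := Ioi τ)
        (fun t ht => by rw [hWzero t (le_of_lt ht), zero_mul]), add_zero]
    rw [heq1, ← heq2]
    obtain ⟨h5a, h5b⟩ := stub_windowTransform ν τ hν hτ0
    exact h6' ν hν hνν₁ τ hττ₁ W hWcont.measurable hWbd hWzero h5a h5b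
  have hearly : |∫ t in Ioi (0:ℝ), W t * cN t| ≤ ((N:ℝ) - 1) * (ε / 8) + ε / 8 * N + ε / 8 * N := by
    rw [hearly_eq, hdecomp]
    have hN1' : (0:ℝ) ≤ (N:ℝ) - 1 := by linarith
    calc |((N:ℝ) - 1) * (∫ t in Ioc (0:ℝ) τ, W t * C t) + (∫ t in Ioc (0:ℝ) τ, W t * E t) +
            ∫ t in Ioc (0:ℝ) τ, W t * R t|
        ≤ |((N:ℝ) - 1) * ∫ t in Ioc (0:ℝ) τ, W t * C t| + |∫ t in Ioc (0:ℝ) τ, W t * E t| +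
            |∫ t in Ioc (0:ℝ) τ, W t * R t| := abs_add_three _ _ _
      _ = ((N:ℝ) - 1) * |∫ t in Ioc (0:ℝ) τ, W t * C t| + |∫ t in Ioc (0:ℝ) τ, W t * E t| +
            |∫ t in Ioc (0:ℝ) τ, W t * R t| := by rw [abs_mul, abs_of_nonneg hN1']
      _ ≤ ((N:ℝ) - 1) * (ε / 8) + ε / 8 * N + ε / 8 * N := by gcongr
  -- assemble
  rw [hsplit]
  calc |(∫ t in Ioi (0:ℝ), W t * cN t) + ∫ t in Ioi (0:ℝ), L t * cN t|
      ≤ |∫ t in Ioi (0:ℝ), W t * cN t| + |∫ t in Ioi (0:ℝ), L t * cN t| := abs_add_le _ _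
    _ ≤ (((N:ℝ) - 1) * (ε / 8) + ε / 8 * N + ε / 8 * N) + ε / 8 * N := add_le_add hearly hlate
    _ ≤ ε * N := by nlinarith

/-- The `EmbeddedDrudeMourre` and `StaticAbelianSqueeze` copies of the crux are one proposition (so the certificate serves
both, and the three split copies, verbatim). -/
theorem uniformAbelianRegularity_edm_eq_sas :
    _root_.Summit.AtomisticToContinuum.FouriersLaw.Theses.EmbeddedDrudeMourre.UniformAbelianRegularity =
      _root_.Summit.AtomisticToContinuum.FouriersLaw.Theses.StaticAbelianSqueeze.UniformAbelianRegularity :=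
  rfl

end Summit.AtomisticToContinuum.FouriersLaw.Theorems.UniformAbelianRegularity.ZeroMeanDyadicSplice

end
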